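import Literature.NumberTheory.LFunctions.Zhang2022.Section8ProfileSjTerms
import HarnessLib

/-!
# Zhang (2022) §8 for profile data: THE ROW (S) FOR `C²` SHORT PIECES — `α⁻¹S_j(𝐚_u, conj 𝐚_u) = 𝔪_j(u)·𝔞 + o(𝔞)` under
# (A), i.e. `KnifeEdge.SjProfileRow c′ j u u′`, for every `c′`, `j = 1,2,3` and every `C²` piece vanishing from `θ < 1` on

Topic `Literature/NumberTheory/LFunctions/Zhang2022` (Landau–Siegel audit tree; verdict-neutral). Y. Zhang, *Discrete mean
estimates and the Landau–Siegel zero*, arXiv:2211.02515v1 (2022) [Zhang2022LandauSiegel] — **an unrefereed manuscript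
under adjudication; nothing here asserts or denies its Theorems 1–2; no claim about Landau–Siegel zeros.** Cell
landau-siegel §D, crux K0 = stmt-Parity-20459 `InClassSideTablesPiece` (line «sjrows», stub `stub_sjRows`: the row (S)
`KnifeEdge.SjProfileRow`, p537807), prover ls-knife-K0-p1 g2. This file GATHERS (Zhang's «Gathering these results together
we conclude, by simple approximation … substituting `n = dr` … it follows by partial integration», §8 pp. 47–48, for a general
`C²` profile in place of `ϰ₁`): the exact form (`Sj_profTable_eq_split`), the good range (`good_range_bound`: LEMMA A
`psiRow_C2` × LEMMA A* `antiRow_C2` with Lemma 8.4 in the relative form of record `lemma84Rel_holds` and the `ξ₀` log-mean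
`xiZeroLogMean_le`), the sliver (`sliver_range_bound`), (8.10) (`mainDouble_eq`), the range-sum engine
(`Section8RangeEngine.weighted_sum_integral_eval`), the substitution `t = e^{zΛ}`, and the jet dictionary
(`Section8DipoleJets`) — every error `≤ K·𝓛⁻¹` (`Section8ProfileSjBounds`), `𝔞 ≥ a₀` under (A) (`frakALowerBound_holds`).

* `sjProfileRow_C2` — **for every `c′`, every `θ ∈ (0,1)` and every `u` with `u, u′, u″` continuous on `[0,θ]`,
  `HasDerivAt u (u′ y) y`, `HasDerivAt u′ (u″ y) y` for `y < θ`, `u = 0` on `[θ,∞)`, `u′ = 0` on `(θ,∞)`: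
  `SjProfileRow c′ j u u′` for `j ∈ {1,2,3}`.**

What this is NOT: the row for a general `KinkedProfile` (`H¹`) piece (the registered `stub_sjRows` quantifies over all
`InClassPiece`s); kinks inside `(0,θ)` and merely-`L²` derivatives are not treated here.

## References
* Y. Zhang, arXiv:2211.02515v1 (2022), §7 Prop 7.1; §8 Lemmas 8.2–8.4, (8.10)–(8.12), pp. 47–48.
  [cite: Zhang2022LandauSiegel, §8 pp.47–48]
-/

noncomputable section

open Complex Real MeasureTheory Set intervalIntegral Filter Finset
open scoped ComplexConjugate Topology

namespace Literature.NumberTheory.LFunctions.Zhang2022.DipoleRule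

open Skeleton KnifeEdge

/-- Threshold bookkeeping: `K/c ≤ ℓ` (with `c, ℓ > 0`, `K ≥ 0`) gives `K/ℓ ≤ c`. [folklore] -/
private theorem div_le_of_div_le {K c ℓ : ℝ} (hc : 0 < c) (hℓ : 0 < ℓ) (h : K / c ≤ ℓ) : K / ℓ ≤ c := by
  rw [div_le_iff₀ hℓ]
  rw [div_le_iff₀ hc] at h
  nlinarith

/-! ### The theorem -/

set_option maxHeartbeats 800000 in
/-- **ROW (S) FOR `C²` SHORT PIECES.** For every `c′`, every `θ ∈ (0,1)`, every `j ∈ {1,2,3}` and every profile `u` with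
`u, u′, u″` continuous on `[0,θ]`, `HasDerivAt u (u′ y) y` and `HasDerivAt u′ (u″ y) y` for all `y < θ`, `u = 0` on `[θ,∞)`
and `u′ = 0` on `(θ,∞)`: `KnifeEdge.SjProfileRow c′ j u u′`, i.e. under (A), eventually in `D`,
`‖α⁻¹S_j(𝐚_u, conj 𝐚_u) − 𝔪_j(u)·𝔞‖ ≤ ε𝔞` — Zhang's (8.9)–(8.12) for a general `C²` short piece in place of `ϰ₁, ϰ₂`.
[cite: Zhang2022LandauSiegel, §8 Lemmas 8.2–8.4, (8.10)–(8.12), pp.47–48] -/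
theorem sjProfileRow_C2 (c' : ℝ) {u u' u'' : ℝ → ℂ} {θ : ℝ} (hθ0 : 0 < θ) (hθ1 : θ < 1)
    (hu : ContinuousOn u (Icc 0 θ)) (hu' : ContinuousOn u' (Icc 0 θ)) (hu'' : ContinuousOn u'' (Icc 0 θ))
    (hd : ∀ y : ℝ, y < θ → HasDerivAt u (u' y) y) (hd' : ∀ y : ℝ, y < θ → HasDerivAt u' (u'' y) y)
    (hvan : ∀ y : ℝ, θ ≤ y → u y = 0) (hvan' : ∀ y : ℝ, θ < y → u' y = 0) {j : ℕ}
    (hj : j ∈ ({1, 2, 3} : Finset ℕ)) : SjProfileRow c' j u u' := by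
  intro ε hε
  -- profile bounds
  obtain ⟨b₀, hb₀⟩ := isCompact_Icc.exists_bound_of_continuousOn hu
  obtain ⟨b₁, hb₁⟩ := isCompact_Icc.exists_bound_of_continuousOn hu'
  obtain ⟨b₂, hb₂⟩ := isCompact_Icc.exists_bound_of_continuousOn hu''
  have hB00 : 0 ≤ max b₀ 0 := le_max_right _ _
  have hB10 : 0 ≤ max b₁ 0 := le_max_right _ _
  have hB20 : 0 ≤ max b₂ 0 := le_max_right _ _
  have hB0 : ∀ y ∈ Icc 0 θ, ‖u y‖ ≤ max b₀ 0 := fun y hy => (hb₀ y hy).trans (le_max_left _ _)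
  have hB1 : ∀ y ∈ Icc 0 θ, ‖u' y‖ ≤ max b₁ 0 := fun y hy => (hb₁ y hy).trans (le_max_left _ _)
  have hB2 : ∀ y ∈ Icc 0 θ, ‖u'' y‖ ≤ max b₂ 0 := fun y hy => (hb₂ y hy).trans (le_max_left _ _)
  generalize max b₀ 0 = B₀ at hB00 hB0
  generalize max b₁ 0 = B₁ at hB10 hB1
  generalize max b₂ 0 = B₂ at hB20 hB2
  -- the one-sided derivative hypotheses of the rows
  have hdW : ∀ y ∈ Ioo 0 θ, HasDerivWithinAt u (u' y) (Ioi y) y := fun y hy => (hd y hy.2).hasDerivWithinAt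
  have hdW' : ∀ y ∈ Ioo 0 θ, HasDerivWithinAt u' (u'' y) (Ioi y) y := fun y hy => (hd' y hy.2).hasDerivWithinAt
  have hdI : ∀ y ∈ Ico 0 θ, HasDerivAt u (u' y) y := fun y hy => hd y hy.2
  have hBuz : ∀ z ∈ Icc 0 θ, ‖u z‖ ≤ B₁ * (θ - z) :=
    fun z hz => norm_le_mul_sub_of_vanish hu hdI (hvan θ le_rfl) hB1 hz
  -- the tree inputs
  obtain ⟨C84raw, h84⟩ := lemma84Rel_holds c'
  obtain ⟨Cξ, hCξ0, hξ⟩ := xiZeroLogMean_le c'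
  obtain ⟨Ceng, heng⟩ := Section8RangeEngine.weighted_sum_integral_eval c'
  obtain ⟨a₀, ha₀, hAlow⟩ := frakALowerBound_holds
  have hC840 : 0 ≤ max C84raw 0 := le_max_right _ _
  -- the constants
  have hG0 : 0 ≤ Gbound c' := (Gbound_pos c').le
  have hC820 : 0 ≤ Lemma82.C82 0 := by
    unfold Lemma82.C82; have := Lemma82.I0_nonneg; positivity
  obtain ⟨KE, hKEdef, hKE0⟩ : ∃ KE : ℝ, KE = ((Lemma82.C82 0 * ((Gbound c' + 1) ^ 2 * (B₀ + B₁ + B₂))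
            + (Gbound c' + 1) ^ 2 * (B₀ + B₁ + B₂) * (2 + 4 * Real.exp (9 / 2)))
          * (4 * Real.exp (9 / 2) * (B₁ + 2 * Gbound c' * B₀ + Gbound c' ^ 2 * (B₀ * θ))
            + (max C84raw 0 * ((1 + (3 * π / 2 + 1) ^ 2) * (B₀ + B₁ + B₂))
              + 2 * ((3 * π / 2 + 1) ^ 2 * (B₀ + B₁ + B₂))
                * (108 * Cξ + 4 * Real.exp (9 / 2) *
                  (1 + 2 * (Gbound c' ^ 2 / (3 * π / 2) ^ 2) + 2 * ((Gbound c' + 3 * π / 2) ^ 2 / (3 * π / 2))))))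
        + 4 * Real.exp (9 / 2) * (Gbound c' * B₀ + B₁) *
          (max C84raw 0 * ((1 + (3 * π / 2 + 1) ^ 2) * (B₀ + B₁ + B₂))
            + 2 * ((3 * π / 2 + 1) ^ 2 * (B₀ + B₁ + B₂))
              * (108 * Cξ + 4 * Real.exp (9 / 2) *
                (1 + 2 * (Gbound c' ^ 2 / (3 * π / 2) ^ 2) + 2 * ((Gbound c' + 3 * π / 2) ^ 2 / (3 * π / 2)))))) ∧
      0 ≤ KE := ⟨_, rfl, by positivity⟩
  obtain ⟨KS, hKSdef, hKS0⟩ : ∃ KS : ℝ, KS = 8 * 3 ^ 5 * Real.exp 430 / π * B₁ ^ 2 * Cξ ∧ 0 ≤ KS :=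
    ⟨_, rfl, by positivity⟩
  obtain ⟨Keng, hKengdef, hKeng0⟩ : ∃ Keng : ℝ, Keng = |Ceng| / π *
      ((Gbound c' * B₀ + B₁) * (B₁ + 2 * Gbound c' * B₀ + Gbound c' ^ 2 * (B₀ * θ))
        + ((Gbound c' * B₁ + B₂) * (B₁ + 2 * Gbound c' * B₀ + Gbound c' ^ 2 * (B₀ * θ))
          + (Gbound c' * B₀ + B₁) * (B₂ + 2 * Gbound c' * B₁ + Gbound c' ^ 2 * B₀))) ∧ 0 ≤ Keng :=
    ⟨_, rfl, by positivity⟩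
  obtain ⟨Kjet, hKjetdef, hKjet0⟩ : ∃ Kjet : ℝ, Kjet = (15 * π * |c'| * π * B₀ *
      (B₁ + 2 * Gbound c' * B₀ + Gbound c' ^ 2 * (B₀ * θ))
          + (B₁ + π * j * B₀) * (30 * π * |c'| * π * B₀
              + 9 * π ^ 2 * (10 * |c'| * π + 25 * c' ^ 2 * π ^ 2) * (B₀ * θ))) * θ / π ∧ 0 ≤ Kjet :=
    ⟨_, rfl, by positivity⟩
  obtain ⟨Ktail, hKtaildef, hKtail0⟩ : ∃ Ktail : ℝ, Ktail = 2 * ((Gbound c' * B₀ + B₁)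
      * (B₁ + 2 * Gbound c' * B₀ + Gbound c' ^ 2 * (B₀ * θ))) / π ∧ 0 ≤ Ktail := ⟨_, rfl, by positivity⟩
  -- threshold (a sum of nonnegative thresholds dominates each of them)
  have h1θ0 : 0 < 1 - θ := by linarith only [hθ1]
  have hεa : 0 < ε / 5 * a₀ := by positivity
  have hε5 : 0 < ε / 5 := by positivity
  have ht1 : 0 ≤ 4 * Real.exp 430 / π * KE / (ε / 5 * a₀) := by positivity
  have ht2 : 0 ≤ KS / (ε / 5 * a₀) := by positivity
  have ht3 : 0 ≤ Keng / (ε / 5 * a₀) := by positivity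
  have ht4 : 0 ≤ Kjet / (ε / 5) := by positivity
  have ht5 : 0 ≤ Ktail / (ε / 5) := by positivity
  have ht6 : 0 ≤ 4 / θ := by positivity
  have ht7 : 0 ≤ 2 / (1 - θ) + 1 := by positivity
  obtain ⟨L₀, hL₀⟩ : ∃ L₀ : ℝ, L₀ = 4 + 4 / θ + (2 / (1 - θ) + 1) + 4 * Real.exp 430 / π * KE / (ε / 5 * a₀)
      + KS / (ε / 5 * a₀) + Keng / (ε / 5 * a₀) + Kjet / (ε / 5) + Ktail / (ε / 5) := ⟨_, rfl⟩
  have hLbig : ForAllLarge fun D _ _ => L₀ ≤ Real.log D :=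
    ForAllLarge.of_le ⌈Real.exp L₀⌉₊ fun D _ _ hD _ _ => le_log_of_ceil_exp_le hD
  refine ((((h84.and hξ).and heng).and hAlow).and hLbig).mono ?_
  intro D _ χ hq hp ⟨⟨⟨⟨h84D, hξD⟩, hengD⟩, hAD⟩, hLD⟩ hA
  have hL4 : 4 ≤ Real.log D := by linarith only [hLD, hL₀, ht1, ht2, ht3, ht4, ht5, ht6, ht7]
  have hLθ : 4 / θ ≤ Real.log D := by linarith only [hLD, hL₀, ht1, ht2, ht3, ht4, ht5, ht6, ht7]
  have hL1θ : 2 / (1 - θ) + 1 ≤ Real.log D := by linarith only [hLD, hL₀, ht1, ht2, ht3, ht4, ht5, ht6, ht7]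
  have hT1 : 4 * Real.exp 430 / π * KE / (ε / 5 * a₀) ≤ Real.log D := by
    linarith only [hLD, hL₀, ht1, ht2, ht3, ht4, ht5, ht6, ht7]
  have hT2 : KS / (ε / 5 * a₀) ≤ Real.log D := by linarith only [hLD, hL₀, ht1, ht2, ht3, ht4, ht5, ht6, ht7]
  have hT3 : Keng / (ε / 5 * a₀) ≤ Real.log D := by linarith only [hLD, hL₀, ht1, ht2, ht3, ht4, ht5, ht6, ht7]
  have hT4 : Kjet / (ε / 5) ≤ Real.log D := by linarith only [hLD, hL₀, ht1, ht2, ht3, ht4, ht5, ht6, ht7]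
  have hT5 : Ktail / (ε / 5) ≤ Real.log D := by linarith only [hLD, hL₀, ht1, ht2, ht3, ht4, ht5, ht6, ht7]
  -- scales
  have hL3 : 3 ≤ Real.log D := by linarith only [hL4]
  have hℓ1 : 1 ≤ Real.log D := by linarith only [hL4]
  have hℓ0 : 0 < Real.log D := by linarith only [hL4]
  obtain ⟨hτθ, hY2, hYP, hlogY1, hθN, h2L⟩ := scales_large hθ0 hθ1 hL4 hLθ hL1θ
  have hΛ0 : 0 < Real.log D ^ 9 := by positivity
  have hL1pos : 0 < Real.log D ^ (11 / 10 : ℝ) := Real.rpow_pos_of_pos hℓ0 _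
  have hτ0 : 0 ≤ 2 * Real.log D ^ (11 / 10 : ℝ) / Real.log D ^ 9 := by positivity
  have hY1 : 1 ≤ Real.exp ((θ - 2 * Real.log D ^ (11 / 10 : ℝ) / Real.log D ^ 9) * Real.log D ^ 9) := by
    linarith only [hY2]
  have hYX : Real.exp ((θ - 2 * Real.log D ^ (11 / 10 : ℝ) / Real.log D ^ 9) * Real.log D ^ 9)
      ≤ Real.exp (θ * Real.log D ^ 9) := by
    rw [Real.exp_le_exp, sub_mul]
    linarith only [mul_nonneg hτ0 hΛ0.le]
  have hA' : ‖χ.LFunction 1‖ ≤ 1 / Real.log D ^ 2022 := le_of_lt hA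
  have ha₀le : a₀ ≤ frakA χ := hAD hA
  have hfrakA0 : 0 ≤ frakA χ := ha₀.le.trans ha₀le
  -- Lemma 8.4's content at this modulus, μ = 6
  have h84good : ∀ d r : ℕ, 1 ≤ d → 1 ≤ r →
      ((d * r : ℕ) : ℝ) < Real.exp ((θ - 2 * Real.log D ^ (11 / 10 : ℝ) / Real.log D ^ 9) * Real.log D ^ 9) →
      ∀ y : ℝ, bigT D < y → y < bigP D →
      ‖(∑ n ∈ Finset.Ico 1 ⌈y⌉₊, χ (n : ZMod D) * xiZero c' D j n d r / (n : ℂ) *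
            ((y / n : ℝ) : ℂ) ^ (-betaMu D 6) * (Real.log (y / n) : ℂ)) -
          deriv χ.LFunction 1 * PiW χ d r * frakgW c' D j 6 y‖
        ≤ max C84raw 0 * (Real.log D ^ 6)⁻¹ * (∏ q ∈ (d * r).primeFactors, (1 - (q : ℝ)⁻¹)⁻¹) ^ 2 := by
    intro d r hd1 hr1 hdr y hy1 hy2
    have hdrN : ((d * r : ℕ) : ℝ) < bigP D / bigT D ^ 2 := by
      have h1 : ((d * r : ℕ) : ℝ) < (Nsupp D : ℝ) := lt_trans (lt_of_lt_of_le hdr hYX) hθN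
      have h2 : d * r < Nsupp D := by exact_mod_cast h1
      exact Nat.lt_ceil.mp h2
    have h := h84D hA j hj 6 (by simp) d r hd1 hr1 hdrN y hy1 hy2
    refine h.trans ?_
    have hrel := Section8FrontEnd44ReductionRel.one_le_relFac (d * r)
    have : C84raw * (ell D ^ 6)⁻¹ ≤ max C84raw 0 * (Real.log D ^ 6)⁻¹ := by
      rw [ell]; exact mul_le_mul_of_nonneg_right (le_max_left _ _) (by positivity)
    exact mul_le_mul_of_nonneg_right this (by positivity)
  -- the `ξ₀` log-means up to `e^{τ₁Λ} = T²`
  have hΞ : ∀ d r : ℕ, ∀ y : ℝ, 1 ≤ y →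
      y ≤ Real.exp (2 * Real.log D ^ (11 / 10 : ℝ) / Real.log D ^ 9 * Real.log D ^ 9) →
      ∑ n ∈ Finset.Ico 1 ⌈y⌉₊, ‖xiZero c' D j n d r‖ / n ≤ Cξ * (1 + 2 * Real.log D ^ (11 / 10 : ℝ)) ^ 3 := by
    intro d r y hy1 hyτ
    have hτΛ : 2 * Real.log D ^ (11 / 10 : ℝ) / Real.log D ^ 9 * Real.log D ^ 9 = 2 * Real.log D ^ (11 / 10 : ℝ) :=
      div_mul_cancel₀ _ hΛ0.ne'
    have hlogy : Real.log y ≤ 2 * Real.log D ^ (11 / 10 : ℝ) := by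
      rw [← hτΛ, ← Real.log_exp (2 * Real.log D ^ (11 / 10 : ℝ) / Real.log D ^ 9 * Real.log D ^ 9)]
      exact Real.log_le_log (by linarith only [hy1]) hyτ
    have h := hξD j d r y hy1 (hlogy.trans h2L)
    refine h.trans ?_
    have hlog0 : 0 ≤ Real.log y := Real.log_nonneg hy1
    gcongr
  have hΞ0 : 0 ≤ Cξ * (1 + 2 * Real.log D ^ (11 / 10 : ℝ)) ^ 3 := by positivity
  -- (1) exact split of `S_j`
  have hYK : ⌈Real.exp ((θ - 2 * Real.log D ^ (11 / 10 : ℝ) / Real.log D ^ 9) * Real.log D ^ 9)⌉₊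
      ≤ ⌈Real.exp (θ * Real.log D ^ 9)⌉₊ := Nat.ceil_mono hYX
  have hY1N : 1 ≤ ⌈Real.exp ((θ - 2 * Real.log D ^ (11 / 10 : ℝ) / Real.log D ^ 9) * Real.log D ^ 9)⌉₊ :=
    Nat.one_le_iff_ne_zero.mpr (Nat.pos_iff_ne_zero.mp (Nat.ceil_pos.mpr (by linarith only [hY2])))
  have hKN : ⌈Real.exp (θ * Real.log D ^ 9)⌉₊ ≤ Nsupp D := Nat.ceil_le.mpr hθN.le
  have hS := Sj_profTable_eq_split c' hq j hvan hℓ0 hY1N hYK (Nat.le_ceil _) hKN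
  -- (2) the good range and (3) the sliver
  have hgood := good_range_bound c' χ hq hp j hL3 hA' hθ0.le hθ1 hu hu' hu'' hdW hdW' hvan hB00 hB10 hB20
    hB0 hB1 hB2 hθN hY1 hC840 hΞ0 h84good (fun d r _ _ _ => hΞ d r)
  have hsliver := sliver_range_bound c' χ hq j hvan hBuz hB10 hℓ0 hθN hY1 (fun d r _ _ _ => hΞ d r)
  -- (4) the collapse by (8.10)
  have hMD := mainDouble_eq c' χ hq j u u' θ
    ⌈Real.exp ((θ - 2 * Real.log D ^ (11 / 10 : ℝ) / Real.log D ^ 9) * Real.log D ^ 9)⌉₊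
  -- (5) the engine
  obtain ⟨hFd, hFM, hFM'⟩ := engineProfile_bounds (γ := betaJ c' D j * Real.log D ^ 9) (σ := sigmaJ c' D j)
    (ν := nuJ c' D j) hu hd hd' hB0 hB1 hB2 hΛ0 hlogY1
  have hM0 : 0 ≤ (‖betaJ c' D j * Real.log D ^ 9‖ * B₀ + B₁)
      * (B₁ + ‖sigmaJ c' D j‖ * B₀ + ‖nuJ c' D j‖ * (B₀ * θ)) := by positivity
  have hM'0 : 0 ≤ ((‖betaJ c' D j * Real.log D ^ 9‖ * B₁ + B₂) * (B₁ + ‖sigmaJ c' D j‖ * B₀ + ‖nuJ c' D j‖ * (B₀ * θ))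
      + (‖betaJ c' D j * Real.log D ^ 9‖ * B₀ + B₁) * (B₂ + ‖sigmaJ c' D j‖ * B₁ + ‖nuJ c' D j‖ * B₀))
        / Real.log D ^ 9 := by positivity
  have heng' := hengD j hj _ _ _ _ hY2 hYP hM0 hM'0 hFd hFM hFM'
  -- (6) the substitution and the split of the main integral
  have hsub := integral_engineProfile_eq (γ := betaJ c' D j * Real.log D ^ 9) (σ := sigmaJ c' D j)
    (ν := nuJ c' D j) (θ := θ) (u := u) (u' := u') hΛ0 (θ - 2 * Real.log D ^ (11 / 10 : ℝ) / Real.log D ^ 9)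
  have hbmem : θ - 2 * Real.log D ^ (11 / 10 : ℝ) / Real.log D ^ 9 ∈ Icc 0 θ :=
    ⟨by linarith only [hτθ, hθ0], by linarith only [hτ0]⟩
  obtain ⟨hsplit2, htail⟩ := integral_prodProfile_split (γ := betaJ c' D j * Real.log D ^ 9) (σ := sigmaJ c' D j)
    (ν := nuJ c' D j) hθ0.le hu hu' hB0 hB1 hbmem
  -- (7) the jets and the `[0,1]` vs `[0,θ]` integral
  have hjet := jetTerm_le c' hL3 hj hu hvan hθ0.le hθ1.le hB00 hB0 hB1
  have hk0 := integral_k0_eq (j := j) (s := Repair.bS j) (N := Repair.bN j) hu hu' hvan hvan' hθ0.le hθ1.le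
  -- (8) the scalars
  have hα : alpha D = π / Real.log D ^ 9 := by rw [alpha, bigP, Real.log_exp]; rfl
  have hαpos : 0 < alpha D := by rw [hα]; positivity
  have hαΛr : alpha D * Real.log D ^ 9 = π := by rw [hα]; field_simp
  have hαΛ : ((alpha D : ℝ) : ℂ)⁻¹ * ((Real.log D ^ 9 : ℝ) : ℂ)⁻¹ = (((1 / π : ℝ)) : ℂ) := by
    rw [← mul_inv, ← Complex.ofReal_mul, hαΛr, Complex.ofReal_div, Complex.ofReal_one, one_div]
  have hΛΛ : ((Real.log D ^ 9 : ℝ) : ℂ)⁻¹ * ((Real.log D ^ 9 : ℝ) : ℂ) = 1 :=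
    inv_mul_cancel₀ (by exact_mod_cast hΛ0.ne')
  have hm : sjProfileMain j u u' = -(((1 / π : ℝ)) : ℂ) *
      ∫ z in (0:ℝ)..1, k0jet j u u' z * k0mass (Repair.bS j) (Repair.bN j) (fun t => conj (u t)) (fun t => conj (u' t)) z :=
    rfl
  -- (9) the identity
  have hid := final_identity (a := ((frakA χ : ℝ) : ℂ)) hS hMD hsub hsplit2 hk0 hm hαΛ hΛΛ
  rw [hid]
  -- (10) the five bounds
  have nαi : ‖((alpha D : ℝ) : ℂ)⁻¹‖ = Real.log D ^ 9 / π := by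
    rw [norm_inv, Complex.norm_real, Real.norm_of_nonneg hαpos.le, hα, inv_div]
  have nΛi : ‖((Real.log D ^ 9 : ℝ) : ℂ)⁻¹‖ = (Real.log D ^ 9)⁻¹ := by
    rw [norm_inv, Complex.norm_real, Real.norm_of_nonneg hΛ0.le]
  have nπi : ‖(((1 / π : ℝ)) : ℂ)‖ = 1 / π := by
    rw [Complex.norm_real, Real.norm_of_nonneg (by positivity)]
  have na : ‖((frakA χ : ℝ) : ℂ)‖ = frakA χ := by rw [Complex.norm_real, Real.norm_of_nonneg hfrakA0]
  -- T1
  have hERR := errGood_le c' χ hp hL3 j hB00 hB10 hB20 hC840 hCξ0 hθ0.le (θ := θ) (Cξ := Cξ)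
  rw [← hKEdef] at hERR
  have T1 : ‖((alpha D : ℝ) : ℂ)⁻¹ * ((∑ n ∈ Finset.Ico 1
      ⌈Real.exp ((θ - 2 * Real.log D ^ (11 / 10 : ℝ) / Real.log D ^ 9) * Real.log D ^ 9)⌉₊,
        ∑ p ∈ Nat.divisorsAntidiagonal n, sjWeight c' χ j p * (psiSum c' D χ j u n * antiSum c' D χ j u p.1 p.2))
      - ∑ n ∈ Finset.Ico 1 ⌈Real.exp ((θ - 2 * Real.log D ^ (11 / 10 : ℝ) / Real.log D ^ 9) * Real.log D ^ 9)⌉₊,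
        ∑ p ∈ Nat.divisorsAntidiagonal n,
          sjWeight c' χ j p * (psiMain c' D χ j u u' n * antiMain c' D χ j u u' θ p))‖ ≤ ε / 5 * frakA χ := by
    rw [norm_mul, nαi]
    have hlogY : Real.log (Real.exp ((θ - 2 * Real.log D ^ (11 / 10 : ℝ) / Real.log D ^ 9) * Real.log D ^ 9))
        ≤ Real.log D ^ 9 := by
      rw [Real.log_exp, sub_mul]
      have h1 : θ * Real.log D ^ 9 ≤ 1 * Real.log D ^ 9 := mul_le_mul_of_nonneg_right hθ1.le hΛ0.le
      linarith only [mul_nonneg hτ0 hΛ0.le, h1]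
    have hlogY0 : 0 ≤ Real.log (Real.exp ((θ - 2 * Real.log D ^ (11 / 10 : ℝ) / Real.log D ^ 9) * Real.log D ^ 9)) := by
      rw [Real.log_exp]
      exact mul_nonneg (by linarith only [hτθ, hθ0]) hΛ0.le
    have hE0 : 0 ≤ errGood c' D j B₀ B₁ B₂ (max C84raw 0) (Cξ * (1 + 2 * Real.log D ^ (11 / 10 : ℝ)) ^ 3)
        ‖deriv χ.LFunction 1‖ θ := by
      unfold errGood deltaM0 deltaN0 antiK0 psiJ0; positivity
    have h1 := goodTerm_le hℓ1 hE0 hlogY hlogY0 hgood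
    refine h1.trans ?_
    calc 4 * Real.exp 430 / π * errGood c' D j B₀ B₁ B₂ (max C84raw 0)
          (Cξ * (1 + 2 * Real.log D ^ (11 / 10 : ℝ)) ^ 3) ‖deriv χ.LFunction 1‖ θ
        ≤ 4 * Real.exp 430 / π * (KE / Real.log D) := mul_le_mul_of_nonneg_left hERR (by positivity)
      _ = 4 * Real.exp 430 / π * KE / Real.log D := by ring
      _ ≤ ε / 5 * a₀ := div_le_of_div_le hεa hℓ0 hT1
      _ ≤ ε / 5 * frakA χ := by gcongr
  -- T2
  have T2 : ‖((alpha D : ℝ) : ℂ)⁻¹ * ∑ n ∈ Finset.Ico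
      ⌈Real.exp ((θ - 2 * Real.log D ^ (11 / 10 : ℝ) / Real.log D ^ 9) * Real.log D ^ 9)⌉₊
      ⌈Real.exp (θ * Real.log D ^ 9)⌉₊,
        ∑ p ∈ Nat.divisorsAntidiagonal n, sjWeight c' χ j p * (psiSum c' D χ j u n * antiSum c' D χ j u p.1 p.2)‖
      ≤ ε / 5 * frakA χ := by
    rw [norm_mul, nαi]
    have h1 := sliverTerm_le hL3 hCξ0 hsliver
    rw [← hKSdef] at h1
    refine h1.trans ?_
    calc KS / Real.log D ≤ ε / 5 * a₀ := div_le_of_div_le hεa hℓ0 hT2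
      _ ≤ ε / 5 * frakA χ := by gcongr
  -- T3
  have T3 : ‖((alpha D : ℝ) : ℂ)⁻¹ * ((Real.log D ^ 9 : ℝ) : ℂ)⁻¹ ^ 2 *
      (deriv χ.LFunction 1 ^ 2 *
          (∑ n ∈ Finset.Ico 1 ⌈Real.exp ((θ - 2 * Real.log D ^ (11 / 10 : ℝ) / Real.log D ^ 9) * Real.log D ^ 9)⌉₊,
            (‖χ (n : ZMod D)‖ : ℂ) * lamZero c' D j n / (Nat.totient n : ℂ) *
              engineProfile (betaJ c' D j * Real.log D ^ 9) (sigmaJ c' D j) (nuJ c' D j) θ u u' (Real.log D ^ 9) n)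
        - (frakA χ : ℂ) * ∫ t in (1:ℝ)..Real.exp ((θ - 2 * Real.log D ^ (11 / 10 : ℝ) / Real.log D ^ 9) * Real.log D ^ 9),
            engineProfile (betaJ c' D j * Real.log D ^ 9) (sigmaJ c' D j) (nuJ c' D j) θ u u' (Real.log D ^ 9) t / t)‖
      ≤ ε / 5 * frakA χ := by
    rw [norm_mul, norm_mul, nαi, norm_pow, nΛi, inv_pow, mul_assoc]
    have hMle : (‖betaJ c' D j * Real.log D ^ 9‖ * B₀ + B₁) * (B₁ + ‖sigmaJ c' D j‖ * B₀ + ‖nuJ c' D j‖ * (B₀ * θ))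
        ≤ (Gbound c' * B₀ + B₁) * (B₁ + 2 * Gbound c' * B₀ + Gbound c' ^ 2 * (B₀ * θ)) := by
      have h1 := norm_betaJ_mul_le c' hL3 j
      have h2 := norm_sigmaJ_le c' hL3 j
      have h3 := norm_nuJ_le c' hL3 j
      gcongr
    have hM'le : ((‖betaJ c' D j * Real.log D ^ 9‖ * B₁ + B₂) * (B₁ + ‖sigmaJ c' D j‖ * B₀ + ‖nuJ c' D j‖ * (B₀ * θ))
        + (‖betaJ c' D j * Real.log D ^ 9‖ * B₀ + B₁) * (B₂ + ‖sigmaJ c' D j‖ * B₁ + ‖nuJ c' D j‖ * B₀))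
          / Real.log D ^ 9 * Real.log D ^ 9
        ≤ (Gbound c' * B₁ + B₂) * (B₁ + 2 * Gbound c' * B₀ + Gbound c' ^ 2 * (B₀ * θ))
          + (Gbound c' * B₀ + B₁) * (B₂ + 2 * Gbound c' * B₁ + Gbound c' ^ 2 * B₀) := by
      rw [div_mul_cancel₀ _ hΛ0.ne']
      have h1 := norm_betaJ_mul_le c' hL3 j
      have h2 := norm_sigmaJ_le c' hL3 j
      have h3 := norm_nuJ_le c' hL3 j
      gcongr
    simp only [ell] at heng'
    have h1 := engineTerm_le hℓ1 hM0 hMle hM'0 hM'le heng'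
    rw [← hKengdef] at h1
    refine h1.trans ?_
    have hℓ3 : Real.log D ≤ Real.log D ^ 3 := by
      calc Real.log D = Real.log D ^ 1 := (pow_one _).symm
        _ ≤ Real.log D ^ 3 := pow_le_pow_right₀ hℓ1 (by norm_num)
    calc Keng / Real.log D ^ 3 ≤ Keng / Real.log D := div_le_div_of_nonneg_left hKeng0 hℓ0 hℓ3
      _ ≤ ε / 5 * a₀ := div_le_of_div_le hεa hℓ0 hT3
      _ ≤ ε / 5 * frakA χ := by gcongr
  -- T4
  have T4 : ‖(((1 / π : ℝ)) : ℂ) * (frakA χ : ℂ) *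
      ((∫ z in (0:ℝ)..θ, prodProfile (betaJ c' D j * Real.log D ^ 9) (sigmaJ c' D j) (nuJ c' D j) θ u u' z)
        - ∫ z in (0:ℝ)..θ, k0jet j u u' z * k0mass (Repair.bS j) (Repair.bN j) (fun t => conj (u t))
            (fun t => conj (u' t)) z)‖ ≤ ε / 5 * frakA χ := by
    rw [norm_mul, norm_mul, nπi, na]
    have hi1 := intervalIntegrable_prodProfile (γ := betaJ c' D j * Real.log D ^ 9) (σ := sigmaJ c' D j)
      (ν := nuJ c' D j) hθ0.le hu hu' (a := 0) (b := θ) ⟨le_rfl, hθ0.le⟩ ⟨hθ0.le, le_rfl⟩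
    -- integrability of `𝔧𝔪` on `[0,θ]` is inside `integral_k0_eq`'s proof; redo the difference via `integral_sub`
    rw [← intervalIntegral.integral_sub hi1 ?hi2]
    case hi2 =>
      have hc1 : ContinuousOn (fun y => conj (u y)) (Icc 0 1) :=
        Complex.continuous_conj.comp_continuousOn (continuousOn_Icc_one_of_short hu hvan)
      have htailc : ContinuousOn (fun z => ∫ t in z..1, conj (u t)) (Icc 0 1) := by
        have hint : IntegrableOn (fun x => conj (u x)) (Set.uIcc 0 1) volume := by
          rw [Set.uIcc_of_le zero_le_one]; exact hc1.integrableOn_compact isCompact_Icc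
        have h := intervalIntegral.continuousOn_primitive_interval_left hint
        rwa [Set.uIcc_of_le zero_le_one] at h
      have hK0 : ContinuousOn (fun z => k0mass (Repair.bS j) (Repair.bN j) (fun t => conj (u t)) (fun t => conj (u' t)) z)
          (Icc 0 θ) := by
        unfold k0mass
        exact ((continuousOn_const.mul (htailc.mono (Icc_subset_Icc le_rfl hθ1.le))).add
          (continuousOn_const.mul (Complex.continuous_conj.comp_continuousOn hu))).sub
          (Complex.continuous_conj.comp_continuousOn hu')
      have hJ0 : ContinuousOn (k0jet j u u') (Icc 0 θ) := by
        unfold k0jet; exact hu'.add (continuousOn_const.mul hu)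
      exact ContinuousOn.intervalIntegrable (by rw [Set.uIcc_of_le hθ0.le]; exact hJ0.mul hK0)
    have h1 := jetTerm_le c' hL3 hj hu hvan hθ0.le hθ1.le hB00 hB0 hB1
    rw [← hKjetdef] at h1
    have h2 : 1 / π * ‖∫ z in (0:ℝ)..θ, (prodProfile (betaJ c' D j * Real.log D ^ 9) (sigmaJ c' D j) (nuJ c' D j) θ u u' z
        - k0jet j u u' z * k0mass (Repair.bS j) (Repair.bN j) (fun t => conj (u t)) (fun t => conj (u' t)) z)‖
        ≤ ε / 5 := by
      exact h1.trans (div_le_of_div_le hε5 hℓ0 hT4)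
    calc 1 / π * frakA χ * _ = frakA χ * (1 / π * _) := by ring
      _ ≤ frakA χ * (ε / 5) := mul_le_mul_of_nonneg_left h2 hfrakA0
      _ = ε / 5 * frakA χ := by ring
  -- T5
  have T5 : ‖(((1 / π : ℝ)) : ℂ) * (frakA χ : ℂ) *
      ∫ z in (θ - 2 * Real.log D ^ (11 / 10 : ℝ) / Real.log D ^ 9)..θ,
        prodProfile (betaJ c' D j * Real.log D ^ 9) (sigmaJ c' D j) (nuJ c' D j) θ u u' z‖ ≤ ε / 5 * frakA χ := by
    rw [norm_mul, norm_mul, nπi, na]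
    have htail' : ‖∫ z in (θ - 2 * Real.log D ^ (11 / 10 : ℝ) / Real.log D ^ 9)..θ,
        prodProfile (betaJ c' D j * Real.log D ^ 9) (sigmaJ c' D j) (nuJ c' D j) θ u u' z‖
        ≤ (Real.log D ^ (11 / 10 : ℝ) * 2 / Real.log D ^ 9) *
          ((Gbound c' * B₀ + B₁) * (B₁ + 2 * Gbound c' * B₀ + Gbound c' ^ 2 * (B₀ * θ))) := by
      refine htail.trans ?_
      have e : θ - (θ - 2 * Real.log D ^ (11 / 10 : ℝ) / Real.log D ^ 9)
          = Real.log D ^ (11 / 10 : ℝ) * 2 / Real.log D ^ 9 := by ring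
      rw [e]
      have h1 := norm_betaJ_mul_le c' hL3 j
      have h2 := norm_sigmaJ_le c' hL3 j
      have h3 := norm_nuJ_le c' hL3 j
      gcongr
    have h1 := tailTerm_le hℓ1 (by positivity : 0 ≤ Gbound c' * B₀ + B₁)
      (by positivity : 0 ≤ B₁ + 2 * Gbound c' * B₀ + Gbound c' ^ 2 * (B₀ * θ)) htail'
    rw [← hKtaildef] at h1
    have h2 : 1 / π * ‖∫ z in (θ - 2 * Real.log D ^ (11 / 10 : ℝ) / Real.log D ^ 9)..θ,
        prodProfile (betaJ c' D j * Real.log D ^ 9) (sigmaJ c' D j) (nuJ c' D j) θ u u' z‖ ≤ ε / 5 := by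
      exact h1.trans (div_le_of_div_le hε5 hℓ0 hT5)
    calc 1 / π * frakA χ * _ = frakA χ * (1 / π * _) := by ring
      _ ≤ frakA χ * (ε / 5) := mul_le_mul_of_nonneg_left h2 hfrakA0
      _ = ε / 5 * frakA χ := by ring
  -- sum
  calc _ ≤ ‖((alpha D : ℝ) : ℂ)⁻¹ * (_ - _) + ((alpha D : ℝ) : ℂ)⁻¹ * _
          - ((alpha D : ℝ) : ℂ)⁻¹ * ((Real.log D ^ 9 : ℝ) : ℂ)⁻¹ ^ 2 * (_ - _)
          - (((1 / π : ℝ)) : ℂ) * (frakA χ : ℂ) * (_ - _)‖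
        + ‖(((1 / π : ℝ)) : ℂ) * (frakA χ : ℂ) * _‖ := norm_add_le _ _
    _ ≤ (‖((alpha D : ℝ) : ℂ)⁻¹ * (_ - _) + ((alpha D : ℝ) : ℂ)⁻¹ * _
          - ((alpha D : ℝ) : ℂ)⁻¹ * ((Real.log D ^ 9 : ℝ) : ℂ)⁻¹ ^ 2 * (_ - _)‖
          + ‖(((1 / π : ℝ)) : ℂ) * (frakA χ : ℂ) * (_ - _)‖) + _ := by
        gcongr; exact norm_sub_le _ _
    _ ≤ ((‖((alpha D : ℝ) : ℂ)⁻¹ * (_ - _) + ((alpha D : ℝ) : ℂ)⁻¹ * _‖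
          + ‖((alpha D : ℝ) : ℂ)⁻¹ * ((Real.log D ^ 9 : ℝ) : ℂ)⁻¹ ^ 2 * (_ - _)‖) + _) + _ := by
        gcongr; exact norm_sub_le _ _
    _ ≤ (((‖((alpha D : ℝ) : ℂ)⁻¹ * (_ - _)‖ + ‖((alpha D : ℝ) : ℂ)⁻¹ * _‖) + _) + _) + _ := by
        gcongr; exact norm_add_le _ _
    _ ≤ (((ε / 5 * frakA χ + ε / 5 * frakA χ) + ε / 5 * frakA χ) + ε / 5 * frakA χ) + ε / 5 * frakA χ := by
        gcongr
    _ = ε * frakA χ := by ring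

end Literature.NumberTheory.LFunctions.Zhang2022.DipoleRule

end
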